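import Mathlib
import Literature.NumberTheory.LFunctions.Zhang2022.Section15U008Gamma
import Literature.NumberTheory.LFunctions.Zhang2022.TypedSection15ASubstepsEdges
import Literature.NumberTheory.LFunctions.Zhang2022.Section15U008Alpha
import HarnessLib

/-!
# Zhang (2022) §15 p. 80, `Z22:§15.u008`: "Hence, moving the segment `𝔍(−α)` to `𝔍(−1)` …,
# `Σ_{ψ∈Ψ₁} I₂⁻(ψ) = τ(χ)Σ_{ψ∈Ψ₁} χ(p_ψ)(p_ψt₀)^{−β₃}(1/2πi)∫_{𝔍(−1)}(Σ_m k̃(m)ψ̄(Dm)(Dm)^{s−1})B(s,ψ)ω(s)ds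
# + o(𝔓)`" — the ASSEMBLY EDGE of the route of record RT15-int-1, kernel-checked

Topic `Literature/NumberTheory/LFunctions/Zhang2022` (Landau–Siegel audit tree; verdict-neutral).
Y. Zhang, *Discrete mean estimates and the Landau–Siegel zero*, arXiv:2211.02515v1 (2022)
[Zhang2022LandauSiegel] — **an unrefereed manuscript under adjudication; nothing in this file asserts or
denies its Theorems 1–2.** ZHANG-L discharge lane, leaf `Typed.Section15A.Eq15_6 c′ bChi` (h15_6), node
`Z22:§15.u008` = `Typed.Section15A.Step15_u008 c′` [Z22 p.80, tex L4017–L4033], WP15-internal route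
RT15-int-1 (zl-w15-plan 2026-08-27T00:02Z; the printed order of operations: the relative errors of
u004/u006 are taken ON `𝔍(−α)`, then the main term is moved):

  u008 ⇐ (α) `𝔨₁ = M₁(1+O(𝓛⁻¹²³))` pointwise on `𝔍(−α)` (`Typed.Section15A.Step15_u008alpha`,
        PROVED by zl-w15-p6, `Section15U008Alpha.step15_u008alpha_holds`)
      + (β) `Σ_{ψ∈Ψ₁}∫_{𝔍(−α)}‖M₁ω‖ ≤ C𝔓𝓛¹²²` (`Typed.Section15A.Step15_u008beta`, a hypothesis here)
      + (γ) the exact move of `M₁ω` (`Typed.Section15A.Step15_u008gamma`, PROVED: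
        `Step15u008.step15_u008gamma_holds`, file `Section15U008Gamma`)
      + (δ) = u007 `Typed.Section15A.Step15_u007` (the Dirichlet series of `L L K/L(1−s,ψ̄)` on
        `σ < 0`; the twist `ψ̄(D)D^{s−1}Σk̃ψ̄(m)m^{s−1} = Σk̃ψ̄(Dm)(Dm)^{s−1}` is the tree's exact
        `Typed.Section15A.ktildeSeries_eq_twist`).

This file proves the kernel edge `step15_u008_of : Step15_u008alpha c′ → Step15_u008beta c′ →
Step15_u008gamma c′ → Step15_u007 c′ → Step15_u008 c′`: `Σ I₂⁻ = Σ(1/2πi)∫_{𝔍(−α)}𝔨₁ω` (definition);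
`‖(1/2πi)∫_{𝔍(−α)}(𝔨₁ − M₁)ω‖ ≤ (1/2π)C_α𝓛⁻¹²³∫‖M₁ω‖` per `ψ` ((α); both integrands are continuous on
the segment — holomorphy `Step15u008.differentiableOn_frakk1_omega_left` /
`differentiableOn_mainU008_omega_left`), summed `≤ (C_αC_β/2π)𝔓𝓛⁻¹` ((β)); `(1/2πi)∫_{𝔍(−α)}M₁ω →
(1/2πi)∫_{𝔍(−1)}M₁ω` at cost `Ce^{−c𝓛¹⁰}` ((γ)); and on `𝔍(−1)` (`σ = −½ < 0`) the EXACT rewriting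
`M₁ω = τ(χ)χ(p)(pt₀)^{−β₃}·(Σ_m k̃(m)ψ̄(Dm)(Dm)^{s−1})·B·ω` (u007 + the twist), so that the moved main
term IS the right side of u008. Also the partial closer `step15_u008_of_beta : Step15_u008beta c′ →
Step15_u008 c′` for `c′ ≥ c₀` (all other inputs are tree theorems: (α) by name via `rfl`,
(γ) `step15_u008gamma_holds`, u007 `step15_u007_holds`). Theorems only; no definitions, no named facts.
WHAT THIS IS NOT: a proof of (β), of (15.4), or any claim about Theorems 1–2 of the source or about
Landau–Siegel zeros.

## References

* Y. Zhang, arXiv:2211.02515v1 (2022), §15 p. 80 (tex L4017–L4033); §8 p. 43.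
  [cite: Zhang2022LandauSiegel, §15 p. 80 (u008)]
-/

noncomputable section

open Complex Real Set ComplexConjugate MeasureTheory intervalIntegral

namespace Literature.NumberTheory.LFunctions.Zhang2022.Step15u008

open Literature.NumberTheory.LFunctions.Zhang2022 Skeleton
open Literature.NumberTheory.LFunctions.Zhang2022.Typed.Section15A

/-! ## A. The segment `𝔍(z)` in the parametrisation of `Lemma81.segInt` -/

section Segment

variable {D : ℕ}

/-- The point `z + s₀ + iv` of the segment `𝔍(z)`: real part `½ + z`, imaginary part `2πt₀ + v`.
[cite: Zhang2022LandauSiegel, §7 p. 33 (`𝔍(z)`)] -/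
theorem segPoint_re_im (z v : ℝ) :
    ((z : ℂ) + s0 D + v * I).re = 1 / 2 + z ∧ ((z : ℂ) + s0 D + v * I).im = 2 * π * t0 D + v := by
  constructor
  · simp [Skeleton.s0, SmoothWeight.s0]; ring
  · simp [Skeleton.s0, SmoothWeight.s0]

/-- The segment `𝔍(z)`, `−1 ≤ z ≤ −α`, lies in the closed left rectangle
`[½−1, ½−α] × [2πt₀−𝓛₁, 2πt₀+𝓛₁]` (for `|v| ≤ 𝓛₁`). [cite: Zhang2022LandauSiegel, §15 p. 80] -/
theorem segPoint_mem_leftRect {z : ℝ} (hz1 : -1 ≤ z) (hz2 : z ≤ -alpha D) {v : ℝ}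
    (hv : v ∈ Set.uIcc (-ell1 D) (ell1 D)) (hℓ10 : 0 ≤ ell1 D) :
    (z : ℂ) + s0 D + v * I ∈
      (Set.uIcc (1 / 2 + (-1 : ℝ)) (1 / 2 + (-alpha D)) ×ℂ
        Set.uIcc (2 * π * t0 D - ell1 D) (2 * π * t0 D + ell1 D)) := by
  obtain ⟨hre, him⟩ := segPoint_re_im (D := D) z v
  rw [Set.uIcc_of_le (by linarith)] at hv
  rw [mem_reProdIm, hre, him, Set.uIcc_of_le (by linarith), Set.uIcc_of_le (by linarith)]
  exact ⟨⟨by linarith, by linarith⟩, ⟨by linarith [hv.1], by linarith [hv.2]⟩⟩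

/-- A function holomorphic on the closed left rectangle is continuous along `𝔍(z)` (`−1 ≤ z ≤ −α`) in
the parameter `v ∈ [−𝓛₁, 𝓛₁]`, hence interval integrable there. [cite: Zhang2022LandauSiegel, §15 p. 80] -/
theorem continuousOn_segment_of_leftRect {F : ℂ → ℂ}
    (hF : DifferentiableOn ℂ F (Set.uIcc (1 / 2 + (-1 : ℝ)) (1 / 2 + (-alpha D)) ×ℂ
      Set.uIcc (2 * π * t0 D - ell1 D) (2 * π * t0 D + ell1 D)))
    {z : ℝ} (hz1 : -1 ≤ z) (hz2 : z ≤ -alpha D) (hℓ10 : 0 ≤ ell1 D) :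
    ContinuousOn (fun v : ℝ => F ((z : ℂ) + s0 D + v * I)) (Set.uIcc (-ell1 D) (ell1 D)) := by
  have hpath : Continuous fun v : ℝ => (z : ℂ) + s0 D + v * I := by fun_prop
  refine hF.continuousOn.comp hpath.continuousOn fun v hv => ?_
  exact segPoint_mem_leftRect hz1 hz2 hv hℓ10

end Segment

/-! ## B. On `𝔍(−1)`: the moved main term IS the right side of u008 (u007 + the twist) -/

section OnLeftLine

variable (c' : ℝ) {D : ℕ} [NeZero D] (χ : DirichletCharacter ℂ D) (x : Chr D)

/-- **`M₁(s,ψ) = τ(χ)χ(p)(pt₀)^{−β₃}·(Σ_m k̃(m)ψ̄(Dm)(Dm)^{s−1})·B(s,ψ)` for `σ < 0`**, from u007 at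
`ψ` and `s` ("for `σ < 0` we can write `L L K/L(1−s,ψ̄) = Σ k̃(m)ψ̄(m)m^{s−1}`") and the exact twist
`ψ̄(D)D^{s−1}Σ_m k̃ψ̄(m)m^{s−1} = Σ_m k̃ψ̄(Dm)(Dm)^{s−1}` (`ktildeSeries_eq_twist`).
[cite: Zhang2022LandauSiegel, §15 p. 80, tex L4029–L4033] -/
theorem mainU008alpha_eq_of_u007 {s : ℂ}
    (h7 : x.ψ⁻¹.LFunction (1 - s - beta1 c' D) * x.ψ⁻¹.LFunction (1 - s - beta2 c' D) *
        Kchar D (psiBarFn x) (1 - s - beta3 c' D) / x.ψ⁻¹.LFunction (1 - s) =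
      ∑' m : ℕ, ktilde c' D m * conj (x.ψ (m : ZMod x.p)) / (m : ℂ) ^ (1 - s)) :
    mainU008alpha c' χ x s =
      GammaFactor.tau χ * χ (x.p : ZMod D) * (((x.p : ℝ) * t0 D : ℝ) : ℂ) ^ (-beta3 c' D) *
        (ktildeSeries c' x s * Bpoly χ x s) := by
  rw [← ktildeSeries_eq_twist c' x s, ← h7, mainU008alpha]
  ring

end OnLeftLine

/-! ## C. The assembly edge -/

section Assembly

variable (c' : ℝ)

/-- Per character on `𝔍(−α)`: `‖(1/2πi)∫_{𝔍(−α)}𝔨₁ω − (1/2πi)∫_{𝔍(−α)}M₁ω‖ ≤ (1/2π)·|C_α|𝓛⁻¹²³·∫‖M₁ω‖`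
from the pointwise (α) bound on the segment (both integrands continuous there).
[cite: Zhang2022LandauSiegel, §15 p. 80, tex L4017–L4020] -/
theorem norm_segInt_frakk1_sub_segInt_main_le {D : ℕ} [NeZero D] (χ : DirichletCharacter ℂ D)
    (x : Chr D) {Cα : ℝ} (hD : 3 ≤ D) (hp : χ.IsPrimitive)
    (h22 : ∀ s ∈ prodZeroSetOmega χ x, s.re = 1 / 2)
    (hα0 : 0 < alpha D) (hα1 : alpha D ≤ 1) (hwin : ell1 D < 2 * π * t0 D) (hℓ10 : 0 ≤ ell1 D)
    (hαx : ∀ s : ℂ, MemJ D (-alpha D) s →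
      ‖frakk1 c' χ x s - mainU008alpha c' χ x s‖ ≤ Cα * (ell D ^ 123)⁻¹ * ‖mainU008alpha c' χ x s‖) :
    ‖Lemma81.segInt (t0 D) (ell1 D) ((-alpha D : ℝ) : ℂ) (fun s => frakk1 c' χ x s * omegaW D s) -
        Lemma81.segInt (t0 D) (ell1 D) ((-alpha D : ℝ) : ℂ)
          (fun s => mainU008alpha c' χ x s * omegaW D s)‖ ≤
      1 / (2 * π) * (|Cα| * (ell D ^ 123)⁻¹ *
        ∫ v in (-ell1 D)..ell1 D, ‖mainU008alpha c' χ x (((-alpha D : ℝ) : ℂ) + s0 D + v * I) *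
          omegaW D (((-alpha D : ℝ) : ℂ) + s0 D + v * I)‖) := by
  set K : ℂ → ℂ := fun s => frakk1 c' χ x s * omegaW D s with hK
  set M : ℂ → ℂ := fun s => mainU008alpha c' χ x s * omegaW D s with hM
  set path : ℝ → ℂ := fun v => ((-alpha D : ℝ) : ℂ) + s0 D + v * I with hpath
  have hKd := differentiableOn_frakk1_omega_left c' χ x hD hp h22 hα0 hα1 hwin
  have hMd : DifferentiableOn ℂ M (Set.uIcc (1 / 2 + (-1 : ℝ)) (1 / 2 + (-alpha D)) ×ℂ
      Set.uIcc (2 * π * t0 D - ell1 D) (2 * π * t0 D + ell1 D)) :=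
    differentiableOn_mainU008_omega_left c' χ x h22 hα0 hα1
  have hKc : ContinuousOn (fun v : ℝ => K (path v)) (Set.uIcc (-ell1 D) (ell1 D)) :=
    continuousOn_segment_of_leftRect hKd (by linarith) le_rfl hℓ10
  have hMc : ContinuousOn (fun v : ℝ => M (path v)) (Set.uIcc (-ell1 D) (ell1 D)) :=
    continuousOn_segment_of_leftRect hMd (by linarith) le_rfl hℓ10
  have hKi : IntervalIntegrable (fun v : ℝ => K (path v)) volume (-ell1 D) (ell1 D) :=
    hKc.intervalIntegrable
  have hMi : IntervalIntegrable (fun v : ℝ => M (path v)) volume (-ell1 D) (ell1 D) :=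
    hMc.intervalIntegrable
  have hle : -ell1 D ≤ ell1 D := by linarith
  -- the difference of the two segment integrals
  have hdiff : Lemma81.segInt (t0 D) (ell1 D) ((-alpha D : ℝ) : ℂ) K -
      Lemma81.segInt (t0 D) (ell1 D) ((-alpha D : ℝ) : ℂ) M =
      (1 / (2 * π) : ℂ) * ∫ v in (-ell1 D)..ell1 D, (K (path v) - M (path v)) := by
    rw [intervalIntegral.integral_sub hKi hMi, Lemma81.segInt_def, Lemma81.segInt_def, ← mul_sub]
    rfl
  -- pointwise on the segment
  have hpt : ∀ v ∈ Set.Icc (-ell1 D) (ell1 D),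
      ‖K (path v) - M (path v)‖ ≤ |Cα| * (ell D ^ 123)⁻¹ * ‖M (path v)‖ := by
    intro v hv
    obtain ⟨hre, him⟩ := segPoint_re_im (D := D) (-alpha D) v
    have hmem : MemJ D (-alpha D) (path v) := by
      refine ⟨hre, ?_⟩
      rw [him, show 2 * π * t0 D + v - 2 * π * t0 D = v by ring]
      exact abs_le.mpr ⟨hv.1, hv.2⟩
    have h := hαx (path v) hmem
    have hℓnn : 0 ≤ ell D := Real.log_natCast_nonneg D
    have hM0 : 0 ≤ (ell D ^ 123)⁻¹ * ‖mainU008alpha c' χ x (path v)‖ :=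
      mul_nonneg (inv_nonneg.mpr (pow_nonneg hℓnn _)) (norm_nonneg _)
    have h' : ‖frakk1 c' χ x (path v) - mainU008alpha c' χ x (path v)‖ ≤
        |Cα| * (ell D ^ 123)⁻¹ * ‖mainU008alpha c' χ x (path v)‖ := by
      refine h.trans ?_
      rw [mul_assoc, mul_assoc]
      exact mul_le_mul_of_nonneg_right (le_abs_self Cα) hM0
    have hKM : K (path v) - M (path v) =
        (frakk1 c' χ x (path v) - mainU008alpha c' χ x (path v)) * omegaW D (path v) := by
      simp only [hK, hM]; ring
    rw [hKM, norm_mul, show M (path v) = mainU008alpha c' χ x (path v) * omegaW D (path v) from rfl,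
      norm_mul, ← mul_assoc]
    exact mul_le_mul_of_nonneg_right h' (norm_nonneg _)
  -- integrate
  have hnormi : IntervalIntegrable (fun v : ℝ => ‖K (path v) - M (path v)‖) volume (-ell1 D) (ell1 D) :=
    (hKi.sub hMi).norm
  have hrhs_i : IntervalIntegrable (fun v : ℝ => |Cα| * (ell D ^ 123)⁻¹ * ‖M (path v)‖) volume
      (-ell1 D) (ell1 D) :=
    (hMi.norm.const_mul _)
  have hint : ‖∫ v in (-ell1 D)..ell1 D, (K (path v) - M (path v))‖ ≤
      |Cα| * (ell D ^ 123)⁻¹ * ∫ v in (-ell1 D)..ell1 D, ‖M (path v)‖ := by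
    calc ‖∫ v in (-ell1 D)..ell1 D, (K (path v) - M (path v))‖
        ≤ ∫ v in (-ell1 D)..ell1 D, ‖K (path v) - M (path v)‖ :=
          intervalIntegral.norm_integral_le_integral_norm hle
      _ ≤ ∫ v in (-ell1 D)..ell1 D, |Cα| * (ell D ^ 123)⁻¹ * ‖M (path v)‖ :=
          intervalIntegral.integral_mono_on hle hnormi hrhs_i hpt
      _ = |Cα| * (ell D ^ 123)⁻¹ * ∫ v in (-ell1 D)..ell1 D, ‖M (path v)‖ := by
          rw [intervalIntegral.integral_const_mul]
  have hpre : ‖(1 / (2 * π) : ℂ)‖ = 1 / (2 * π) := by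
    rw [show (1 / (2 * π) : ℂ) = ((1 / (2 * π) : ℝ) : ℂ) by push_cast; ring, Complex.norm_real,
      Real.norm_of_nonneg (by positivity)]
  rw [hdiff, norm_mul, hpre]
  exact mul_le_mul_of_nonneg_left hint (by positivity)

/-- Per character on `𝔍(−1)`: the moved main term IS the printed right side,
`(1/2πi)∫_{𝔍(−1)}M₁ω = τ(χ)χ(p)(pt₀)^{−β₃}·(1/2πi)∫_{𝔍(−1)}(Σ_m k̃ψ̄(Dm)(Dm)^{s−1})Bω` (u007 + twist at
every point of the segment, `σ = −½ < 0`; constants out of the integral).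
[cite: Zhang2022LandauSiegel, §15 p. 80, tex L4029–L4033] -/
theorem segInt_main_eq_rhs {D : ℕ} [NeZero D] (χ : DirichletCharacter ℂ D) (x : Chr D)
    (h7x : ∀ s : ℂ, s.re < 0 →
      x.ψ⁻¹.LFunction (1 - s - beta1 c' D) * x.ψ⁻¹.LFunction (1 - s - beta2 c' D) *
          Kchar D (psiBarFn x) (1 - s - beta3 c' D) / x.ψ⁻¹.LFunction (1 - s) =
        ∑' m : ℕ, ktilde c' D m * conj (x.ψ (m : ZMod x.p)) / (m : ℂ) ^ (1 - s)) :
    Lemma81.segInt (t0 D) (ell1 D) ((-1 : ℝ) : ℂ) (fun s => mainU008alpha c' χ x s * omegaW D s) =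
      GammaFactor.tau χ * (χ (x.p : ZMod D) * (((x.p : ℝ) * t0 D : ℝ) : ℂ) ^ (-beta3 c' D) *
        Lemma81.segInt (t0 D) (ell1 D) (-1)
          (fun s => ktildeSeries c' x s * Bpoly χ x s * omegaW D s)) := by
  have hm1 : ((-1 : ℝ) : ℂ) = -1 := by push_cast; ring
  rw [Lemma81.segInt_def, Lemma81.segInt_def, hm1]
  have hfun : (fun v : ℝ => mainU008alpha c' χ x ((-1 : ℂ) + SmoothWeight.s0 (t0 D) + v * I) *
      omegaW D ((-1 : ℂ) + SmoothWeight.s0 (t0 D) + v * I)) =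
      fun v : ℝ => (GammaFactor.tau χ * χ (x.p : ZMod D) * (((x.p : ℝ) * t0 D : ℝ) : ℂ) ^ (-beta3 c' D)) *
        (ktildeSeries c' x ((-1 : ℂ) + SmoothWeight.s0 (t0 D) + v * I) *
          Bpoly χ x ((-1 : ℂ) + SmoothWeight.s0 (t0 D) + v * I) *
          omegaW D ((-1 : ℂ) + SmoothWeight.s0 (t0 D) + v * I)) := by
    funext v
    have hre : ((-1 : ℂ) + SmoothWeight.s0 (t0 D) + v * I).re < 0 := by
      simp [SmoothWeight.s0]; norm_num
    rw [mainU008alpha_eq_of_u007 c' χ x (h7x _ hre)]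
    ring
  rw [hfun, intervalIntegral.integral_const_mul]
  ring

set_option maxHeartbeats 800000 in
/-- **`Z22:§15.u008` ⇐ (α) + (β) + (γ) + u007** (route RT15-int-1, the printed order of operations made
explicit): for every `c′`, `Step15_u008alpha c′ → Step15_u008beta c′ → Step15_u008gamma c′ →
Step15_u007 c′ → Step15_u008 c′`. Given `ε > 0`: `Σ I₂⁻ − τ(χ)Σχ(p)(pt₀)^{−β₃}(1/2πi)∫_{𝔍(−1)}k̃Bω =
[Σ(1/2πi)∫_{𝔍(−α)}(𝔨₁−M₁)ω] + [Σ(1/2πi)∫_{𝔍(−α)}M₁ω − Σ(1/2πi)∫_{𝔍(−1)}M₁ω]` (the last sum IS the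
printed right side by u007 + twist on `σ = −½`); the first bracket is `≤ (|C_α||C_β|/2π)𝔓/𝓛 ≤ (ε/2)𝔓`, the
second `≤ Ce^{−c𝓛¹⁰} ≤ ε/2 ≤ (ε/2)𝔓` for large `D` (`𝔓 ≥ 2`; Prop. 2.2 (i) `Skeleton.prop22i_holds`
supplies the holomorphy that makes the segment integrands integrable).
[cite: Zhang2022LandauSiegel, §15 p. 80 (u008), tex L4017–L4033] -/
theorem step15_u008_of (hα : Step15_u008alpha c') (hβ : Step15_u008beta c')
    (hγ : Step15_u008gamma c') (h7 : Step15_u007 c') : Step15_u008 c' := by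
  classical
  intro ε hε
  obtain ⟨Cα, Dα, hαD⟩ := hα
  obtain ⟨Cβ, Dβ, hβD⟩ := hβ
  obtain ⟨c, hc, Cγ, Dγ, hγD⟩ := hγ
  obtain ⟨C7, D7, h7D⟩ := h7
  obtain ⟨D₁, h22'⟩ := prop22i_holds
  obtain ⟨D₂, h2P⟩ := Ded81Edge.exists_two_le_frakP
  have hε2 : 0 < ε / 2 := by positivity
  obtain ⟨Dε, hDε⟩ := Ded81Edge.exists_large_exp_le Cγ c (ε / 2) hc hε2
  set L₀ : ℝ := max 3 ((|Cα| * |Cβ| + 1) / ε) with hL₀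
  refine ⟨max (max (max Dα Dβ) (max Dγ D7)) (max (max D₂ Dε) (max D₁ (max ⌈Real.exp L₀⌉₊ 3))),
    fun D _ χ hD hq hp hA => ?_⟩
  have hDa : max (max Dα Dβ) (max Dγ D7) ≤ D := le_trans (le_max_left _ _) hD
  have hDb : max (max D₂ Dε) (max D₁ (max ⌈Real.exp L₀⌉₊ 3)) ≤ D := le_trans (le_max_right _ _) hD
  have hDα : Dα ≤ D := le_trans (le_trans (le_max_left _ _) (le_max_left _ _)) hDa
  have hDβ : Dβ ≤ D := le_trans (le_trans (le_max_right _ _) (le_max_left _ _)) hDa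
  have hDγ : Dγ ≤ D := le_trans (le_trans (le_max_left _ _) (le_max_right _ _)) hDa
  have hD7 : D7 ≤ D := le_trans (le_trans (le_max_right _ _) (le_max_right _ _)) hDa
  have hD2 : D₂ ≤ D := le_trans (le_trans (le_max_left _ _) (le_max_left _ _)) hDb
  have hDε' : Dε ≤ D := le_trans (le_trans (le_max_right _ _) (le_max_left _ _)) hDb
  have hD1 : D₁ ≤ D := le_trans (le_trans (le_max_left _ _) (le_max_right _ _)) hDb
  have hDℓ : ⌈Real.exp L₀⌉₊ ≤ D :=
    le_trans (le_trans (le_trans (le_max_left _ _) (le_max_right _ _)) (le_max_right _ _)) hDb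
  have hD3 : 3 ≤ D :=
    le_trans (le_trans (le_trans (le_max_right _ _) (le_max_right _ _)) (le_max_right _ _)) hDb
  have hL : L₀ ≤ ell D := Section4.le_ell_of_ceil_exp_le hDℓ
  have hℓ3 : 3 ≤ ell D := (le_max_left _ _).trans hL
  have hℓε : (|Cα| * |Cβ| + 1) / ε ≤ ell D := (le_max_right _ _).trans hL
  have hℓ0 : 0 < ell D := by linarith
  have hℓ1 : 1 ≤ ell D := by linarith
  obtain ⟨hα0, -, hα1⟩ := Step8u016.alpha_small hℓ3
  obtain ⟨hwin, -, -, -, hℓ10⟩ := Step8u016.window_sizes hℓ3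
  have hαpt := hαD D χ hDα hq hp
  have hβpt := hβD D χ hDβ hq hp hA
  have hγpt := hγD D χ hDγ hq hp hA
  obtain ⟨-, h7pt⟩ := h7D D χ hD7 hq hp
  have h22D := h22' D χ hD1 hq hp
  have hP2 := h2P D hD2
  have hεpt := hDε D hDε'
  -- notation
  set A : ℂ := ∑ x ∈ finsetOf (PsiOne χ), I2pm c' χ x (-alpha D) with hA_def
  set Gα : ℂ := ∑ x ∈ finsetOf (PsiOne χ), Lemma81.segInt (t0 D) (ell1 D) ((-alpha D : ℝ) : ℂ)
    (fun s => mainU008alpha c' χ x s * omegaW D s) with hGα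
  set G1 : ℂ := ∑ x ∈ finsetOf (PsiOne χ), Lemma81.segInt (t0 D) (ell1 D) ((-1 : ℝ) : ℂ)
    (fun s => mainU008alpha c' χ x s * omegaW D s) with hG1
  -- the printed right side IS `G1`
  have hT : GammaFactor.tau χ * ∑ x ∈ finsetOf (PsiOne χ),
      χ (x.p : ZMod D) * (((x.p : ℝ) * t0 D : ℝ) : ℂ) ^ (-beta3 c' D) *
        Lemma81.segInt (t0 D) (ell1 D) (-1)
          (fun s => ktildeSeries c' x s * Bpoly χ x s * omegaW D s) = G1 := by
    rw [hG1, Finset.mul_sum]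
    refine Finset.sum_congr rfl fun x _ => ?_
    rw [segInt_main_eq_rhs c' χ x (h7pt x)]
  rw [hT]
  -- bound 1: `‖A − Gα‖ ≤ (1/2π)|C_α|𝓛⁻¹²³·C_β𝔓𝓛¹²²`
  have hA_eq : A = ∑ x ∈ finsetOf (PsiOne χ),
      Lemma81.segInt (t0 D) (ell1 D) ((-alpha D : ℝ) : ℂ) (fun s => frakk1 c' χ x s * omegaW D s) := by
    rw [hA_def]; rfl
  have hb1 : ‖A - Gα‖ ≤ 1 / (2 * π) * (|Cα| * (ell D ^ 123)⁻¹ * (Cβ * frakP D * ell D ^ 122)) := by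
    rw [hA_eq, hGα, ← Finset.sum_sub_distrib]
    calc ‖∑ x ∈ finsetOf (PsiOne χ),
          (Lemma81.segInt (t0 D) (ell1 D) ((-alpha D : ℝ) : ℂ) (fun s => frakk1 c' χ x s * omegaW D s) -
            Lemma81.segInt (t0 D) (ell1 D) ((-alpha D : ℝ) : ℂ)
              (fun s => mainU008alpha c' χ x s * omegaW D s))‖
        ≤ ∑ x ∈ finsetOf (PsiOne χ),
          ‖Lemma81.segInt (t0 D) (ell1 D) ((-alpha D : ℝ) : ℂ) (fun s => frakk1 c' χ x s * omegaW D s) -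
            Lemma81.segInt (t0 D) (ell1 D) ((-alpha D : ℝ) : ℂ)
              (fun s => mainU008alpha c' χ x s * omegaW D s)‖ := norm_sum_le _ _
      _ ≤ ∑ x ∈ finsetOf (PsiOne χ), 1 / (2 * π) * (|Cα| * (ell D ^ 123)⁻¹ *
          ∫ v in (-ell1 D)..ell1 D, ‖mainU008alpha c' χ x (((-alpha D : ℝ) : ℂ) + s0 D + v * I) *
            omegaW D (((-alpha D : ℝ) : ℂ) + s0 D + v * I)‖) :=
          Finset.sum_le_sum fun x hx => by
            have hx' : x ∈ PsiOne χ := mem_of_mem_finsetOf hx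
            exact norm_segInt_frakk1_sub_segInt_main_le c' χ x hD3 hp (h22D x hx') hα0 hα1 hwin hℓ10
              (hαpt x hx')
      _ = 1 / (2 * π) * (|Cα| * (ell D ^ 123)⁻¹ *
          ∑ x ∈ finsetOf (PsiOne χ), ∫ v in (-ell1 D)..ell1 D,
            ‖mainU008alpha c' χ x (((-alpha D : ℝ) : ℂ) + s0 D + v * I) *
              omegaW D (((-alpha D : ℝ) : ℂ) + s0 D + v * I)‖) := by
          rw [← Finset.mul_sum, ← Finset.mul_sum]
      _ ≤ 1 / (2 * π) * (|Cα| * (ell D ^ 123)⁻¹ * (Cβ * frakP D * ell D ^ 122)) := by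
          apply mul_le_mul_of_nonneg_left _ (by positivity)
          exact mul_le_mul_of_nonneg_left hβpt
            (mul_nonneg (abs_nonneg _) (inv_nonneg.mpr (pow_nonneg hℓ0.le _)))
  -- bound 2: `‖Gα − G1‖ ≤ C_γ e^{−c𝓛¹⁰} ≤ ε/2`
  have hb2 : ‖Gα - G1‖ ≤ ε / 2 := by
    rw [hGα, hG1]
    exact hγpt.trans hεpt
  -- sizes
  have hP1 : 1 ≤ frakP D := by linarith
  have hne : ell D ≠ 0 := hℓ0.ne'
  have hℓ123 : (ell D ^ 123)⁻¹ * ell D ^ 122 = (ell D)⁻¹ := by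
    rw [pow_succ]; field_simp
  have hb1' : 1 / (2 * π) * (|Cα| * (ell D ^ 123)⁻¹ * (Cβ * frakP D * ell D ^ 122)) ≤ ε / 2 * frakP D := by
    have hCβ : Cβ * frakP D * ell D ^ 122 ≤ |Cβ| * frakP D * ell D ^ 122 := by
      gcongr; exact le_abs_self Cβ
    have h1 : |Cα| * (ell D ^ 123)⁻¹ * (Cβ * frakP D * ell D ^ 122) ≤
        |Cα| * |Cβ| * (ell D)⁻¹ * frakP D := by
      calc |Cα| * (ell D ^ 123)⁻¹ * (Cβ * frakP D * ell D ^ 122)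
          ≤ |Cα| * (ell D ^ 123)⁻¹ * (|Cβ| * frakP D * ell D ^ 122) :=
            mul_le_mul_of_nonneg_left hCβ
              (mul_nonneg (abs_nonneg _) (inv_nonneg.mpr (pow_nonneg hℓ0.le _)))
        _ = |Cα| * |Cβ| * ((ell D ^ 123)⁻¹ * ell D ^ 122) * frakP D := by ring
        _ = |Cα| * |Cβ| * (ell D)⁻¹ * frakP D := by rw [hℓ123]
    have h2 : |Cα| * |Cβ| * (ell D)⁻¹ ≤ ε := by
      rw [← div_eq_mul_inv, div_le_iff₀ hℓ0]
      have := (div_le_iff₀ hε).mp hℓε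
      nlinarith
    have hπ : 1 / (2 * π) ≤ (1 : ℝ) / 2 := by
      rw [div_le_div_iff₀ (by positivity) (by norm_num)]; nlinarith [Real.pi_gt_three]
    calc 1 / (2 * π) * (|Cα| * (ell D ^ 123)⁻¹ * (Cβ * frakP D * ell D ^ 122))
        ≤ 1 / 2 * (|Cα| * |Cβ| * (ell D)⁻¹ * frakP D) :=
          mul_le_mul hπ h1 (by
            have : 0 ≤ |Cα| * (ell D ^ 123)⁻¹ * (Cβ * frakP D * ell D ^ 122) := by
              have h0 : 0 ≤ ∑ x ∈ finsetOf (PsiOne χ), ∫ v in (-ell1 D)..ell1 D,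
                  ‖mainU008alpha c' χ x (((-alpha D : ℝ) : ℂ) + s0 D + v * I) *
                    omegaW D (((-alpha D : ℝ) : ℂ) + s0 D + v * I)‖ :=
                Finset.sum_nonneg fun x _ =>
                  intervalIntegral.integral_nonneg (by linarith) fun v _ => norm_nonneg _
              exact mul_nonneg (mul_nonneg (abs_nonneg _) (inv_nonneg.mpr (pow_nonneg hℓ0.le _)))
                (h0.trans hβpt)
            exact this) (by norm_num)
      _ ≤ 1 / 2 * (ε * frakP D) := by
          apply mul_le_mul_of_nonneg_left _ (by norm_num)
          exact mul_le_mul_of_nonneg_right h2 (by linarith)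
      _ = ε / 2 * frakP D := by ring
  -- assemble
  calc ‖A - G1‖ = ‖(A - Gα) + (Gα - G1)‖ := by congr 1; ring
    _ ≤ ‖A - Gα‖ + ‖Gα - G1‖ := norm_add_le _ _
    _ ≤ ε / 2 * frakP D + ε / 2 := add_le_add (hb1.trans hb1') hb2
    _ ≤ ε / 2 * frakP D + ε / 2 * frakP D := by nlinarith
    _ = ε * frakP D := by ring

/-- **`Z22:§15.u008` modulo (β) only**: for every `c′`, `Step15_u008beta c′ → Step15_u008 c′` — (α) is
the tree theorem `Typed.Section15A.step15_u008alpha_holds` (zl-w15-p6; it IS `Step15_u008alpha c′` by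
unfolding `mainU008alpha`), (γ) is `Step15u008.step15_u008gamma_holds`, u007 is
`Typed.Section15A.step15_u007_holds`. [cite: Zhang2022LandauSiegel, §15 p. 80 (u008)] -/
theorem step15_u008_of_beta (hβ : Step15_u008beta c') : Step15_u008 c' :=
  step15_u008_of c' (step15_u008alpha_holds c') hβ (step15_u008gamma_holds c') (step15_u007_holds c')

end Assembly

end Literature.NumberTheory.LFunctions.Zhang2022.Step15u008
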